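import Summits.CriticalPhenomena.PercolationContinuityZ3.Theses.PercNearOneGluing
import Literature.Probability.Percolation.TwoSetExchange
import Literature.Probability.Percolation.KozmaNitzanPreFKG
import HarnessLib

/-!
# Crux `PercNearOneGluing.AdditiveGluing` (stmt-CriticalPhenomena-4576), line `tieline`: the K₀ attachment transfer on `D`
# (registered stub `stub_k0AttachTransferD_c10`)

Support file (`--supports stmt-CriticalPhenomena-4576`, lead c10).  No definitions, no named facts, no sorries.

Weighted graph on `Fin n` (`μ = prodBernoulli w`), relays `u, v`, spectator `c`, observer `o`.  Write
`D = {u ↮ v}`, `N_c = {c ↮ u} ∩ {c ↮ v}`, `J = {o ↔ c}`.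

**Attachment transfer on `D` (`stub_k0AttachTransferD_c10`, (γ'')).**
`μ(D ∩ N_c) · μ(N_c ∩ J) ≤ μ(D ∩ N_c ∩ J) · μ(N_c)`:
conditioned on the cluster of `c` avoiding `{u, v}`, the events `{o ∈ C_c}` and `{u ↮ v}` are positively correlated.

Proof.  One application of the two-SET exchange inequality of van den Berg–Häggström–Kahn (Thm. 2.1 at `q = 1`,
i.e. Thm. 1.5 with the vertices `s, t` replaced by the vertex sets `S = {c}`, `T = {u, v}`; event form
`Literature.Probability.Percolation.setTwoClusterExchange`): the conditioning event is
`{S ↮ T} = {c ↮ u} ∩ {c ↮ v} = N_c`, and both `{u ↮ v}` (`u ∈ T`) and `{c ↔ o}` (`c ∈ S`) are of type `(+)`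
(closed under enlarging `C_S = C_c` and shrinking `C_T = C_u ∪ C_v`), hence positively correlated given `N_c`:
with `A₁ = {u ↮ v}`, `A₂ = {c ↔ o}`, `B₁ = B₂ = univ` the exchange inequality reads
`μ(N_c ∩ A₁) · μ(N_c ∩ A₂) ≤ μ(N_c ∩ (A₁ ∩ A₂)) · μ(N_c)`.
[cite: VandenbergHaggstromKahn2005, Thm. 1.5 (p. 7), Remark 1 after Thm. 1.2 (p. 5), Thm. 2.1 (p. 9)]
[cite: KozmaNitzan2024, §2.2 (p. 5), the BHK inequalities for two clusters]
-/

namespace Summit.CriticalPhenomena.PercolationContinuityZ3.Cruxes.AdditiveGluing.TieLine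

open MeasureTheory Set Literature.Probability.LatticeModels Literature.Probability.Percolation

noncomputable section

namespace K0AttachTransferD

variable {n : ℕ}

/-- The two-set separation event for `S = {c}`, `T = {u, v}`: `{S ↮ T} = {c ↮ u} ∩ {c ↮ v} = N_c`. [folklore] -/
theorem sep_eq (u v c : Fin n) :
    {ω : BondConfig (Fin n) | ∀ s ∈ ({c} : Set (Fin n)), ∀ t ∈ ({u, v} : Set (Fin n)),
        ¬ (openGraph ω).Reachable s t} =
      (openConn c u)ᶜ ∩ (openConn c v)ᶜ := by
  ext ω
  simp only [mem_setOf_eq, mem_singleton_iff, forall_eq, mem_insert_iff, forall_eq_or_imp,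
    mem_inter_iff, mem_compl_iff, openConn]

/-- **BHK Thm. 2.1 (`q = 1`) for `S = {c}`, `T = {u, v}`**: given `N_c = {c ↮ u} ∩ {c ↮ v}`, the type-`(+)` events
`{u ↮ v}` and `{c ↔ o}` are positively correlated:
`μ(N_c ∩ {u↮v}) · μ(N_c ∩ {c↔o}) ≤ μ(N_c ∩ ({u↮v} ∩ {c↔o})) · μ(N_c)`.
[cite: VandenbergHaggstromKahn2005, Thm. 2.1 (p. 9) at q = 1, Remark 1 after Thm. 1.2 (p. 5)] -/
theorem exchange (w : Sym2 (Fin n) → unitInterval) (o u v c : Fin n) :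
    (prodBernoulli w).real ((openConn c u)ᶜ ∩ (openConn c v)ᶜ ∩ (openConn u v)ᶜ : Set (BondConfig (Fin n))) *
        (prodBernoulli w).real ((openConn c u)ᶜ ∩ (openConn c v)ᶜ ∩ openConn c o : Set (BondConfig (Fin n))) ≤
      (prodBernoulli w).real ((openConn c u)ᶜ ∩ (openConn c v)ᶜ ∩ ((openConn u v)ᶜ ∩ openConn c o) :
          Set (BondConfig (Fin n))) *
        (prodBernoulli w).real ((openConn c u)ᶜ ∩ (openConn c v)ᶜ : Set (BondConfig (Fin n))) := by
  have key := setTwoClusterExchange w ({c} : Set (Fin n)) ({u, v} : Set (Fin n))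
    (A₁ := (openConn u v)ᶜ) (A₂ := openConn c o) (B₁ := univ) (B₂ := univ)
    (TwoSetExchange.typePlus_not_openConn_of_mem ({c} : Set (Fin n)) ({u, v} : Set (Fin n))
      (mem_insert u {v}) v)
    (TwoSetExchange.typePlus_openConn_of_mem ({c} : Set (Fin n)) ({u, v} : Set (Fin n))
      (mem_singleton c) o)
    (fun _ _ _ _ _ => mem_univ _) (fun _ _ _ _ _ => mem_univ _)
  rw [sep_eq u v c] at key
  simpa only [inter_univ] using key

end K0AttachTransferD

open K0AttachTransferD in
/-- **Registered stub `stub_k0AttachTransferD_c10`** (K₀ attachment transfer on `D`; line `tieline`, crux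
`AdditiveGluing`): with `D = {u ↮ v}`, `N_c = {c ↮ u} ∩ {c ↮ v}`, `J = {o ↔ c}`:
`μ(D ∩ N_c) · μ(N_c ∩ J) ≤ μ(D ∩ N_c ∩ J) · μ(N_c)` — given `C_c ∩ {u, v} = ∅`, the events `{o ∈ C_c}` and
`{u ↮ v}` are positively correlated (two-set exchange with `S = {c}`, `T = {u, v}`, both events of type `(+)`;
`K0AttachTransferD.exchange` after commuting intersections and `{o ↔ c} = {c ↔ o}`, `KNPreFKG.openConn_symm`).
[cite: VandenbergHaggstromKahn2005, Thm. 1.5 (p. 7), Thm. 2.1 (p. 9)] [cite: KozmaNitzan2024, §2.2 (p. 5)] -/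
theorem stub_k0AttachTransferD_c10 : ∀ (n : ℕ) (w : Sym2 (Fin n) → unitInterval) (o u v c : Fin n), (Literature.Probability.LatticeModels.prodBernoulli w).real ((Literature.Probability.Percolation.openConn u v)ᶜ ∩ ((Literature.Probability.Percolation.openConn c u)ᶜ ∩ (Literature.Probability.Percolation.openConn c v)ᶜ) : Set (Literature.Probability.Percolation.BondConfig (Fin n))) * (Literature.Probability.LatticeModels.prodBernoulli w).real ((Literature.Probability.Percolation.openConn c u)ᶜ ∩ (Literature.Probability.Percolation.openConn c v)ᶜ ∩ Literature.Probability.Percolation.openConn o c : Set (Literature.Probability.Percolation.BondConfig (Fin n))) ≤ (Literature.Probability.LatticeModels.prodBernoulli w).real ((Literature.Probability.Percolation.openConn u v)ᶜ ∩ ((Literature.Probability.Percolation.openConn c u)ᶜ ∩ (Literature.Probability.Percolation.openConn c v)ᶜ) ∩ Literature.Probability.Percolation.openConn o c : Set (Literature.Probability.Percolation.BondConfig (Fin n))) * (Literature.Probability.LatticeModels.prodBernoulli w).real ((Literature.Probability.Percolation.openConn c u)ᶜ ∩ (Literature.Probability.Percolation.openConn c v)ᶜ : Set (Literature.Probability.Percolation.BondConfig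 (Fin n))) := by
  intro n w o u v c
  rw [KNPreFKG.openConn_symm o c, inter_comm ((openConn u v)ᶜ) ((openConn c u)ᶜ ∩ (openConn c v)ᶜ),
    inter_assoc ((openConn c u)ᶜ ∩ (openConn c v)ᶜ) ((openConn u v)ᶜ) (openConn c o)]
  exact exchange w o u v c

end

end Summit.CriticalPhenomena.PercolationContinuityZ3.Cruxes.AdditiveGluing.TieLine
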